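import Summits.CriticalPhenomena.CardyFormulaZ2.Theses.CardyDualCurrent
import Summits.CriticalPhenomena.CardyFormulaZ2.Theorems.CardyDualCurrentCanonicalLimitFromExactCRReduction
import Summits.CriticalPhenomena.CardyFormulaZ2.Cruxes.DualCurrentTemplateR.Lines.birth
import Literature.Probability.LatticeModels.LocalParafermionicTemplate
import HarnessLib

/-!
# Line `local_necessity` — crux `CardyDualCurrent.CanonicalLimitFromExactCR`
(item `stmt-CriticalPhenomena-11394`, route `route-CriticalPhenomena-CardyDualCurrent`,
sub-problem `CardyFormulaZ2`; strategist line, 2026-08-17 — an ALTERNATIVE to the live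
skeleton `Lines/registered.lean`, which it does not touch)

## The crux and why a second line

`CanonicalLimitFromExactCR` is VERBATIM `(body of DualCurrentTemplateR) → (body of
TemplateCanonicalLimit)`, i.e. `r2 → r9` (`canonicalLimitFromExactCR_iff_imp`, `Iff.rfl`), hence
`↔ (¬ r2 ∨ r9)` (`canonicalLimitFromExactCR_iff_not_or`).  The live line (`registered`: SHAPE core
+ SIZE core, both from an abstract exactly-CR non-degenerate template) attacks the `r9` side; eight
lead cycles (CYCLE1–8.md) found both remaining stubs blocked on the decision of r2 and, under r2,
of the strength of Duminil-Copin–Smirnov 2012 Conj. 8.7 / Smirnov 2010 Conj. 2.4 at `σ = 1/3`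
(exact CR fixes neither the Riemann–Hilbert boundary datum — `ThreadedObstruction`, `RealForm` —
nor the scaling dimension — `Shift`).  This line attacks the OTHER disjunct, `¬ r2`, which the
route's KILL CRITERIA name as a legitimate decision value of the thesis, and it does so through
two stubs that are UNCONDITIONAL statements about finite-range templates — provable or refutable
without first deciding r2 (proving both DECIDES r2 negatively; refuting either is news for r2's
own line `birth`).

## The line: exact CR ⟹ local CR ⟹ degenerate

Line `birth` of the sibling crux r2 (`Cruxes/DualCurrentTemplateR/Lines/birth.lean`, imported)
introduced `Birth.IsLocallyCR T` — for some block radius `ρ`, at every deep stencil of every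
admissible domain the block resummation over `edgeBox · ρ` of the Duffin CR defect of the
integrand vanishes FOR EVERY EXTERIOR — and PROVED `Birth.isExactCR_of_isLocallyCR :
IsLocallyCR T → T.IsExactCR` (toggle invariance of `P_{1/2}` + linearity; its two library stubs
landed, p148916 / p148626).  Its structure note (`birth-structure.md` §5 "block data = boundary
conditions", §6.5) records the two facts this line turns into stubs:

* `stub_localNecessity` — **the converse: exact CR in ALL admissible Dobrushin domains forces
  local CR** (`T.IsExactCR → IsLocallyCR T`, so that `IsExactCR ↔ IsLocallyCR`,
  `isExactCR_iff_isLocallyCR` below).  Mechanism ("Dobrushin span"): at a deep stencil the domain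
  enters only through the law of the exterior interface datum of the block (rim stubs open/closed,
  their planar connectivity to each other and to the wired arc, excursion sides, winding class —
  a FINITE set for fixed `(r, ρ)`, §5 of the note); exact CR in `D` is the `P_D`-average of the
  block sums over these data; freezing an exterior configuration into the SHAPE of a new admissible
  Dobrushin domain (wired cluster ↦ wired arc, dual cluster of the free arc ↦ free arc) realises
  the data one at a time, up to floating clusters adjacent to the block, which are removed by
  induction on the number of undecided exterior edges (inclusion–exclusion over small annexes).
  NEW as a typed statement; it closes the gap the note names ("a proof of H for all ρ kills the
  line without touching the crux — exactly-CR templates relying on global cancellations would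
  remain conceivable").
* `stub_conjectureH` — **Conjecture H of the note, constancy form: a locally-CR template is
  constant on the `(r+2)`-deep points of every admissible domain** (`IsLocallyCR T → ∀ D adm.
  preconn., T.IsConstantIn D`).  Evidence: Theorem A of the note (block radius `0`: proved for
  outer-wired domains by the extremal-stencil argument), Prop. S (single-edge block identities
  exist exactly at `σ ≡ ±1/3` and are NULL), and the census CENSUS-c1.md (block radius `1`, all
  four frames: locally-CR kernel = null kernel, dimensions 4/12/16/16 at `r = 0..3` pattern-free,
  520 = 520 with `B₁` patterns at `r = 1`, kit job j025540 16 = 16).  It is EQUIVALENT, over the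
  landed `stub_obsEqBlockAverage` (p148955), to the negation of line `birth`'s heart
  `Sig.stub_localSolution` (`not_stub_localSolution_of_conjectureH` below proves the direction this
  line needs): the two lines are exactly complementary at the heart, so the r2 census decides
  between them range by range, and a structural proof of H ("extremal argument modulo flips") is
  the hardest stub of this line.

`CanonicalLimitFromExactCR_of` (sorry-free): the two stubs give
`∀ T, T.IsExactCR → ¬ T.Nondegenerate` (`Nondegenerate` is by definition the negation of
constancy in all admissible preconnected domains), and the landed reduction
`canonicalLimitFromExactCR_of_forall_not` (p153703) yields the crux BY NAME.  Also recorded: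
`not_dualCurrentTemplateR_of` (the decision value the line computes) and
`isExactCR_iff_isLocallyCR`.

Disproof used: none on file (`ledger crux ls stmt-CriticalPhenomena-11394`: no `Disproof.lean`,
no `Negative/`).  Negatives index (2026-08-17): only stmt-CriticalPhenomena-6949 (junk
`SimpleGraph.dist` windows) on this route; every notion here goes through the repaired
`edist`-based `LocalParafermionicTemplate` API and `Birth.IsLocallyCR`, no stub is an instance.
Checks (2026-08-17, `lean check --json`): rc 0, errors `[]`, sorries 2 = the two `stub_*` declarations
(the only `declaration uses sorry` warnings); the audit block records `CanonicalLimitFromExactCR_of`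
as proving `…Theses.CardyDualCurrent.CanonicalLimitFromExactCR` under exactly the hypotheses
`Sig.stub_localNecessity`, `Sig.stub_conjectureH`.  BC3 probes (strategist folder `bc/probes.lean`:
the two signatures verbatim as `S1`, `S2`, no stubs, no composition; `maxHeartbeats 400000`):
`S1 → CanonicalLimitFromExactCR`, `S2 → CanonicalLimitFromExactCR`, `S1 → CardyFormulaZ2`,
`S2 → CardyFormulaZ2` by `first | exact? | simpa [S] | (unfold S; simpa) | aesop` all FAIL with
unsolved goals (4/4), and so do the converses `CanonicalLimitFromExactCR → S1 / S2` (2/2): no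
stub is cheaply the crux or the summit, and neither is a consequence of the crux.
Why it dodges the STUCK goals of `registered` (`stub_shapeBoundsAndIdentification`,
`stub_sizeCore`: no boundary datum / no amplitude from an abstract witness): it never touches a
witness — both stubs quantify over ALL templates and are finite-combinatorial (stub 1) resp.
finite-combinatorial + extremal (stub 2) statements on the lattice, with no scaling limit in them.
-/

noncomputable section

namespace Summit.CriticalPhenomena.CardyFormulaZ2.Cruxes.CanonicalLimitFromExactCR.LocalNecessity

open scoped Classical
open MeasureTheory
open Literature.Probability.LatticeModels Literature.Probability
open Summit.CriticalPhenomena.CardyFormulaZ2.Theses.CardyDualCurrent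
  (CanonicalLimitFromExactCR DualCurrentTemplateR TemplateCanonicalLimit)
open Summit.CriticalPhenomena.CardyFormulaZ2.Cruxes.DualCurrentTemplateR

/-! ### Stub signatures -/

/-- Signature of `stub_localNecessity` (**Dobrushin span / local necessity**): an exactly
discrete-holomorphic finite-range template is locally Cauchy–Riemann — for some block radius `ρ`
the block resummation of its CR defect vanishes for every exterior, at every deep stencil of every
admissible domain with preconnected wired arc.  The converse of the landed
`Birth.isExactCR_of_isLocallyCR`. -/
def Sig.stub_localNecessity : Prop :=
  ∀ T : LocalParafermionicTemplate, T.IsExactCR → Birth.IsLocallyCR T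

/-- Signature of `stub_conjectureH` (**Conjecture H, constancy form**): a locally Cauchy–Riemann
template is constant on the `(T.r + 2)`-deep vertices of each type in every admissible domain
with preconnected wired arc (`LocalParafermionicTemplate.IsConstantIn`). -/
def Sig.stub_conjectureH : Prop :=
  ∀ T : LocalParafermionicTemplate, Birth.IsLocallyCR T →
    ∀ D : DiscreteDobrushin, D.IsZdAdmissible →
      ((discreteDomainGraph D.Ω D.δ).induce D.zdArcA).Preconnected → T.IsConstantIn D

/-! ### The stubs -/

/-- stub 1 — LOCAL NECESSITY (open; size L): exact CR in all admissible Dobrushin domains forces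
the block identity for every exterior ("Dobrushin exterior laws span the block boundary data";
realisation of exterior data by domain shapes + induction on undecided exterior edges). -/
theorem stub_localNecessity : Sig.stub_localNecessity := by
  sorry

/-- stub 2 — CONJECTURE H (open; size XL; the hardest stub): locally CR ⟹ constant on deep points
(Theorem A at block radius 0; "extremal-stencil argument modulo the flip identities of Prop. S"
at block radius ≥ 1; census-backed at radius 1 for ranges ≤ 3). -/
theorem stub_conjectureH : Sig.stub_conjectureH := by
  sorry

/-! ### Consequences of the stubs (sorry-free given the stubs as hypotheses) -/

/-- With local necessity, exact CR and local CR coincide (the other direction is the landed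
`Birth.isExactCR_of_isLocallyCR`, from `stub_blockResummation` p148916 and
`stub_integrandIntegrable` p148626). -/
theorem isExactCR_iff_isLocallyCR (h₁ : Sig.stub_localNecessity) (T : LocalParafermionicTemplate) :
    T.IsExactCR ↔ Birth.IsLocallyCR T :=
  ⟨h₁ T, Birth.isExactCR_of_isLocallyCR Birth.stub_blockResummation Birth.stub_integrandIntegrable T⟩

/-- The two stubs make every exactly-CR template degenerate. -/
theorem not_nondegenerate_of_isExactCR (h₁ : Sig.stub_localNecessity) (h₂ : Sig.stub_conjectureH)
    (T : LocalParafermionicTemplate) (hT : T.IsExactCR) : ¬ T.Nondegenerate :=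
  fun hN => hN (h₂ T (h₁ T hT))

/-- The decision value this line computes: the route's rank-2 crux `DualCurrentTemplateR` FAILS. -/
theorem not_dualCurrentTemplateR_of (h₁ : Sig.stub_localNecessity) (h₂ : Sig.stub_conjectureH) :
    ¬ DualCurrentTemplateR := fun hR => by
  obtain ⟨T, hCR, hND⟩ :=
    LocalParafermionicTemplate.exists_isExactCR_and_nondegenerate_iff.2 hR
  exact not_nondegenerate_of_isExactCR h₁ h₂ T hCR hND

/-- Conjecture H (constancy form) refutes the heart `Sig.stub_localSolution` of line `birth` of the
sibling crux r2: a finite non-constancy certificate between two `(r+2)`-deep points contradicts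
constancy, both block averages being the observable (`Birth.stub_obsEqBlockAverage`, landed
p148955, depth `r + 2 ⇒ r`).  The two lines are complementary at the heart. -/
theorem not_stub_localSolution_of_conjectureH (h₂ : Sig.stub_conjectureH) :
    ¬ Birth.Sig.stub_localSolution := by
  rintro ⟨T, hloc, D, E, x, x', i, hD, hA, hEΩ, hEzd, hx, hx', hne⟩
  apply hne
  have h : T.obs D x i = T.obs D x' i := h₂ T hloc D hD hA x x' i hx hx'
  rwa [Birth.obs_eq_blockAverage Birth.stub_obsEqBlockAverage T hD hEΩ hEzd
      (hx.mono (Nat.le_add_right _ _)),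
    Birth.obs_eq_blockAverage Birth.stub_obsEqBlockAverage T hD hEΩ hEzd
      (hx'.mono (Nat.le_add_right _ _))] at h

/-! ### The composition (sorry-free): the stubs give the crux BY NAME -/

/-- **`CanonicalLimitFromExactCR` from the two stubs.**  Local necessity and Conjecture H make
every exactly discrete-holomorphic finite-range template degenerate; the landed reduction
`canonicalLimitFromExactCR_of_forall_not` (Theorems file
`CardyDualCurrentCanonicalLimitFromExactCRReduction`, p153703) turns that all-ranges negative
statement into the crux. -/
theorem CanonicalLimitFromExactCR_of
    (h₁ : Sig.stub_localNecessity) (h₂ : Sig.stub_conjectureH) :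
    Summit.CriticalPhenomena.CardyFormulaZ2.Theses.CardyDualCurrent.CanonicalLimitFromExactCR :=
  Summit.CriticalPhenomena.CardyFormulaZ2.Theorems.canonicalLimitFromExactCR_of_forall_not
    (not_nondegenerate_of_isExactCR h₁ h₂)

end Summit.CriticalPhenomena.CardyFormulaZ2.Cruxes.CanonicalLimitFromExactCR.LocalNecessity

end
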